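import Summits.ValiantsHypothesis.ValiantsHypothesis.Theorems.BarrierLeverAnchoredDoorHitsLowerPairsStarSpec

/-!
# Support item `AnchoredDoorHitsLowerPairs` (stmt-ValiantsHypothesis-22510), line `anchored-peeling`:
# the DECISION-TREE PEEL — part 1: generalized layouts and the one-vertex specialisation

Helper file (`--supports stmt-ValiantsHypothesis-22510`; cell valiant-natproofs, rung V4, 𝒟-side door (c); registered line
`Cruxes/AnchoredDoorHitsLowerPairs/Lines/anchored_peeling.lean` v5; prover seat val-np-p1 gen 17). Definition-light
(bookkeeping `def`s only: generalized layout entries / matrix / determinant, the one-variable substitution `dtSpec` and the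
weights it uses, the variable-killing substitution `killX`). Closes NO item.

THE DEVICE (memo HOME/val-np-p1/g17/DTPEEL-MEMO-valnp1-g17.md). A GENERALIZED ROW of the anchored door is a pair `(U | E)`
(`U ⊆ X` an `x`-set, `E ⊆ Y` a `y`-SHIFT); its entry against the column `T` is `[E ⊆ T] · [x^U y^{T ∖ E}] 𝔄_s`
(`genEntry`); ordinary rows are `(S | ∅)` (`genDet_empty : genDet … (fun _ => ∅) … = symbolicDet …`). Fix an `x`-vertex `a`
and a TYPE LIST `(B_j, c_j, D_j)_{j < J}` — `x`-tail sets `B_j ⊆ X ∖ a`, pairwise DISTINCT anchor columns `c_j ∈ Y`, `y`-tail sets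
`D_j ⊆ Y ∖ c_j`. The one-variable substitution `dtSpec` sends `θ_{(a|c_j)} ↦ T^{Lt j}`, `φ_{(a|c_j), b} ↦ T^L [b ∈ B_j]`,
`ψ_{(a|c_j), d} ↦ T^L [d ∈ D_j]`, every other parameter of an anchor containing `a` and every `x`-twist AT `a` to `0`, and keeps
all remaining parameters as constants. This file computes the substituted witness:
`dtSpec(𝔄_s) = C(𝔄_s|_{x_a := 0}) · ∏_j (1 + x_a · T^{Lt j} y_{c_j} ∏_{b ∈ B_j}(1 + T^L x_b) ∏_{d ∈ D_j}(1 + T^L y_d))`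
(`map_dtHom_symbolicWitness`), and the entries of the substituted generalized layout (`coeff_F0_mul_Q`, `genEntry_dtHom_of_not_mem`).
The sequel `…DTPeel` adds the degree count and the DT-PEEL LEMMA: `genDet` of the PEELED layout `≠ 0` ⇒ `genDet ≠ 0`.

WHAT THIS IS NOT: no statement about items 22510 / 19717 themselves; nothing on crux stmt-ValiantsHypothesis-14610 or on
`VP` versus `VNP`.
-/

set_option linter.dupNamespace false

namespace Summit.ValiantsHypothesis.ValiantsHypothesis.Theorems.BarrierLever.AnchoredPeeling

open Finset MvPolynomial
open Summit.ValiantsHypothesis.ValiantsHypothesis.Theorems.BarrierLever.BrickCalculus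
  (pexpo pexpo_def pexpo_le_iff pexpo_sub pexpo_apply_castAdd pexpo_apply_natAdd)

noncomputable section

namespace DTPeel

variable {h : ℕ}

/-! ## 1. Generalized layouts -/

/-- The entry of the generalized row `(U | E)` against the column `T`: `[E ⊆ T] · [x^U y^{T ∖ E}] 𝔄_s`. -/
def genEntry (s h : ℕ) (U E T : Finset (Fin h)) : MvPolynomial (Param h) ℂ :=
  if E ⊆ T then coeff (pexpo U (T \ E)) (symbolicWitness s h) else 0

/-- The generalized layout matrix of the rows `(U i | E i)` against the columns `w j`. -/
def genMatrix (s h r : ℕ) (U E w : Fin r → Finset (Fin h)) : Matrix (Fin r) (Fin r) (MvPolynomial (Param h) ℂ) :=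
  Matrix.of fun i j => genEntry s h (U i) (E i) (w j)

/-- Its determinant, the generalized symbolic minor. -/
def genDet (s h r : ℕ) (U E w : Fin r → Finset (Fin h)) : MvPolynomial (Param h) ℂ :=
  (genMatrix s h r U E w).det

/-- With all shifts empty the generalized symbolic minor is the symbolic minor of the layout. -/
theorem genDet_empty (s h r : ℕ) (u w : Fin r → Finset (Fin h)) :
    genDet s h r u (fun _ => ∅) w = symbolicDet s h r u w := by
  unfold genDet genMatrix genEntry symbolicDet
  congr 1
  ext i j
  rw [Matrix.of_apply, Matrix.of_apply, if_pos (Finset.empty_subset _), Finset.sdiff_empty, pexpo_def]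

/-! ## 2. Killing one variable of the witness -/

section Kill

variable {R : Type*} [CommSemiring R] {σ : Type*} [DecidableEq σ]

/-- The substitution `x_v := 0` (all other variables kept). -/
def killX (v : σ) : MvPolynomial σ R →ₐ[R] MvPolynomial σ R :=
  aeval fun u => if u = v then 0 else X u

/-- `killX v` on a variable. -/
theorem killX_X (v u : σ) : killX (R := R) v (X u) = if u = v then 0 else X u := by
  rw [killX, aeval_X]

/-- `killX v` fixes constants. -/
theorem killX_C (v : σ) (c : R) : killX v (C c) = C c := by
  rw [killX, ← algebraMap_eq, AlgHom.commutes]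

/-- On a monomial: kept if `v` does not occur, killed otherwise. -/
theorem killX_monomial (v : σ) (m : σ →₀ ℕ) (c : R) :
    killX v (monomial m c) = if m v = 0 then monomial m c else 0 := by
  classical
  rw [killX, aeval_monomial, algebraMap_eq]
  by_cases hv : m v = 0
  · rw [if_pos hv, monomial_eq]
    congr 1
    rw [Finsupp.prod, Finsupp.prod]
    refine Finset.prod_congr rfl (fun u hu => ?_)
    have huv : u ≠ v := by
      rintro rfl
      exact (Finsupp.mem_support_iff.mp hu) hv
    rw [if_neg huv]
  · rw [if_neg hv]
    have hmem : v ∈ m.support := Finsupp.mem_support_iff.mpr hv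
    rw [Finsupp.prod, ← Finset.mul_prod_erase _ _ hmem, if_pos rfl, zero_pow hv, zero_mul, mul_zero]

/-- **Coefficients after killing `x_v`**: unchanged on `v`-free monomials, zero otherwise. -/
theorem coeff_killX (v : σ) (f : MvPolynomial σ R) (m : σ →₀ ℕ) :
    coeff m (killX v f) = if m v = 0 then coeff m f else 0 := by
  classical
  induction f using MvPolynomial.induction_on' with
  | monomial u c =>
    rw [killX_monomial]
    by_cases hu : u v = 0
    · rw [if_pos hu, coeff_monomial]
      by_cases hum : u = m
      · subst hum; rw [if_pos rfl, if_pos hu]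
      · rw [if_neg hum]; split_ifs <;> rfl
    · rw [if_neg hu, coeff_zero, coeff_monomial]
      by_cases hum : u = m
      · subst hum; rw [if_neg hu]
      · rw [if_neg hum]; split_ifs <;> rfl
  | add p q hp hq =>
    rw [map_add, coeff_add, coeff_add, hp, hq]
    split_ifs <;> simp

end Kill

/-- `x`-variable of the vertex `a`. -/
abbrev xv (h : ℕ) (a : Fin h) : Fin (h + h) := Fin.castAdd h a

/-- The witness with `x_a := 0`: its `a`-free layout entries are those of the witness (`coeff_kill_symbolicWitness`). -/
theorem coeff_kill_symbolicWitness (s h : ℕ) (a : Fin h) (U V : Finset (Fin h)) (ha : a ∉ U) :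
    coeff (pexpo U V) (killX (xv h a) (symbolicWitness s h)) = coeff (pexpo U V) (symbolicWitness s h) := by
  rw [coeff_killX, pexpo_apply_castAdd, if_neg ha, if_pos rfl]

/-- Killing `x_a` turns every anchor factor whose `x`-part contains `a` into `1`. -/
theorem killX_symbFactor_of_mem (a : Fin h) {α : Finset (Fin h) × Finset (Fin h)} (ha : a ∈ α.1) :
    killX (xv h a) (symbFactor h α) = 1 := by
  have hzero : killX (R := MvPolynomial (Param h) ℂ) (xv h a) (∏ a' ∈ α.1, X (Fin.castAdd h a')) = 0 := by
    rw [map_prod]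
    exact Finset.prod_eq_zero ha (by rw [killX_X, if_pos rfl])
  rw [symbFactor, map_add, map_one, map_mul, map_mul, map_mul, map_mul, hzero, mul_zero, zero_mul, zero_mul, zero_mul,
    add_zero]

/-! ## 3. The type list, its weights, and the one-variable substitution -/

section Spec

variable (a : Fin h) {J : ℕ} (B : Fin J → Finset (Fin h)) (c : Fin J → Fin h) (D : Fin J → Finset (Fin h))

/-- The anchor `(a | c_j)` of type `j`. -/
def anch (a : Fin h) (c : Fin J → Fin h) (j : Fin J) : Finset (Fin h) × Finset (Fin h) := ({a}, {c j})

/-- Tail weight `L = J + 1` (the same for every `x`- and `y`-tail of a designated anchor). -/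
def tailW (J : ℕ) : ℕ := J + 1

/-- Anchor weight `Lt j = (J - 1 - j) + (2h - |B_j| - |D_j|)·L`. -/
def anchW (j : Fin J) : ℕ := (J - 1 - j) + (2 * h - (B j).card - (D j).card) * tailW J

/-- Top weight of type `j`: `W_j = (J - 1 - j) + 2h·L` (`= Lt j + (|B_j| + |D_j|)·L`); strictly decreasing in `j`,
with total spread `J - 1 < L`. -/
def topW (h J : ℕ) (j : Fin J) : ℕ := (J - 1 - j) + 2 * h * tailW J

/-- The one-variable substitution of the parameters attached to the vertex `a` and the type list:
`θ_{(a|c_j)} ↦ T^{Lt j}`, `φ_{(a|c_j), b} ↦ T^L [b ∈ B_j]`, `ψ_{(a|c_j), d} ↦ T^L [d ∈ D_j]`; every other parameter of an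
anchor whose `x`-part contains `a` ↦ `0`; every `x`-twist at `a` ↦ `0`; all remaining parameters kept as constants. The sums
over `j` with `α = (a | c_j)` have at most one term. -/
def dtSpec : Param h → Polynomial (MvPolynomial (Param h) ℂ)
  | Sum.inl α =>
      if a ∈ α.1 then ∑ j ∈ univ.filter (fun j => anch a c j = α), Polynomial.X ^ anchW B D j
      else Polynomial.C (X (Sum.inl α))
  | Sum.inr (Sum.inl (α, b)) =>
      if a ∈ α.1 then ∑ j ∈ univ.filter (fun j => anch a c j = α), (if b ∈ B j then Polynomial.X ^ tailW J else 0)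
      else if b = a then 0 else Polynomial.C (X (Sum.inr (Sum.inl (α, b))))
  | Sum.inr (Sum.inr (α, d)) =>
      if a ∈ α.1 then ∑ j ∈ univ.filter (fun j => anch a c j = α), (if d ∈ D j then Polynomial.X ^ tailW J else 0)
      else Polynomial.C (X (Sum.inr (Sum.inr (α, d))))

/-- The substitution as a ring map `ℂ[θ, φ, ψ] → ℂ[θ, φ, ψ][T]`. -/
def dtHom : MvPolynomial (Param h) ℂ →+* Polynomial (MvPolynomial (Param h) ℂ) :=
  (aeval (dtSpec a B c D)).toRingHom

/-- The substitution on a parameter variable. -/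
theorem dtHom_X (v : Param h) : dtHom a B c D (X v) = dtSpec a B c D v := by
  rw [dtHom, AlgHom.toRingHom_eq_coe, RingHom.coe_coe, aeval_X]

variable {a c}

/-- With pairwise distinct anchor columns, the designated anchor `(a | c_j)` determines `j`. -/
theorem filter_anch_eq (hc : Function.Injective c) (j : Fin J) :
    univ.filter (fun j' => anch a c j' = anch a c j) = {j} := by
  ext j'
  simp only [mem_filter, mem_univ, true_and, mem_singleton, anch, Prod.mk.injEq, Finset.singleton_inj, true_and]
  exact ⟨fun h' => hc h', fun h' => by rw [h']⟩

/-- A non-designated anchor has an empty filter. -/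
theorem filter_anch_empty {α : Finset (Fin h) × Finset (Fin h)} (hα : ∀ j, anch a c j ≠ α) :
    univ.filter (fun j => anch a c j = α) = ∅ := by
  ext j
  simp only [mem_filter, mem_univ, true_and, Finset.notMem_empty, iff_false]
  exact hα j

variable (a c)

/-! ### The substituted anchor factors -/

/-- `x`-variables versus the distinguished one. -/
@[simp] theorem castAdd_eq_xv_iff {a b : Fin h} : Fin.castAdd h b = xv h a ↔ b = a := Fin.castAdd_inj

/-- `y`-variables are never the distinguished `x`-variable. -/
@[simp] theorem natAdd_eq_xv_iff {a d : Fin h} : Fin.natAdd h d = xv h a ↔ False := by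
  constructor
  · intro heq
    have hv := congrArg Fin.val heq
    simp only [Fin.natAdd, Fin.castAdd, xv, Fin.castLE] at hv
    omega
  · exact False.elim

/-- An anchor NOT containing `a` in its `x`-part: its parameters become constants and its `x`-twist at `a` dies — the same as
killing `x_a` and embedding. -/
theorem map_dtHom_symbFactor_of_not_mem {α : Finset (Fin h) × Finset (Fin h)} (hα : a ∉ α.1) :
    MvPolynomial.map (dtHom a B c D) (symbFactor h α) =
      MvPolynomial.map Polynomial.C (killX (xv h a) (symbFactor h α)) := by
  -- the five pieces of the factor, one by one
  have hθ : MvPolynomial.map (dtHom a B c D) (C (X (Sum.inl α)) : MvPolynomial (Fin (h + h)) (MvPolynomial (Param h) ℂ)) =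
      MvPolynomial.map Polynomial.C (killX (xv h a) (C (X (Sum.inl α)))) := by
    simp only [map_C, dtHom_X, dtSpec, if_neg hα, killX_C]
  have hxc : MvPolynomial.map (dtHom a B c D)
        (∏ a' ∈ α.1, X (Fin.castAdd h a') : MvPolynomial (Fin (h + h)) (MvPolynomial (Param h) ℂ)) =
      MvPolynomial.map Polynomial.C (killX (xv h a) (∏ a' ∈ α.1, X (Fin.castAdd h a'))) := by
    rw [map_prod, map_prod, map_prod]
    refine Finset.prod_congr rfl (fun a' ha' => ?_)
    have hne : ¬ (Fin.castAdd h a' = xv h a) := fun heq => hα (by rw [← castAdd_eq_xv_iff.mp heq]; exact ha')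
    rw [map_X, killX_X, if_neg hne, map_X]
  have hyc : MvPolynomial.map (dtHom a B c D)
        (∏ c' ∈ α.2, X (Fin.natAdd h c') : MvPolynomial (Fin (h + h)) (MvPolynomial (Param h) ℂ)) =
      MvPolynomial.map Polynomial.C (killX (xv h a) (∏ c' ∈ α.2, X (Fin.natAdd h c'))) := by
    rw [map_prod, map_prod, map_prod]
    refine Finset.prod_congr rfl (fun c' _ => ?_)
    rw [map_X, killX_X, if_neg (fun heq => natAdd_eq_xv_iff.mp heq), map_X]
  have hxt : MvPolynomial.map (dtHom a B c D)
        (∏ b ∈ univ \ α.1, (1 + C (X (Sum.inr (Sum.inl (α, b)))) * X (Fin.castAdd h b)) :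
          MvPolynomial (Fin (h + h)) (MvPolynomial (Param h) ℂ)) =
      MvPolynomial.map Polynomial.C
        (killX (xv h a) (∏ b ∈ univ \ α.1, (1 + C (X (Sum.inr (Sum.inl (α, b)))) * X (Fin.castAdd h b)))) := by
    rw [map_prod, map_prod, map_prod]
    refine Finset.prod_congr rfl (fun b _ => ?_)
    simp only [map_add, map_one, map_mul, map_C, map_X, dtHom_X, dtSpec, if_neg hα, killX_C, killX_X, castAdd_eq_xv_iff]
    by_cases hb : b = a
    · rw [if_pos hb, if_pos hb, map_zero, map_zero, zero_mul, mul_zero]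
    · rw [if_neg hb, if_neg hb, map_X]
  have hyt : MvPolynomial.map (dtHom a B c D)
        (∏ d ∈ univ \ α.2, (1 + C (X (Sum.inr (Sum.inr (α, d)))) * X (Fin.natAdd h d)) :
          MvPolynomial (Fin (h + h)) (MvPolynomial (Param h) ℂ)) =
      MvPolynomial.map Polynomial.C
        (killX (xv h a) (∏ d ∈ univ \ α.2, (1 + C (X (Sum.inr (Sum.inr (α, d)))) * X (Fin.natAdd h d)))) := by
    rw [map_prod, map_prod, map_prod]
    refine Finset.prod_congr rfl (fun d _ => ?_)
    simp only [map_add, map_one, map_mul, map_C, map_X, dtHom_X, dtSpec, if_neg hα, killX_C, killX_X]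
    rw [if_neg (fun heq => natAdd_eq_xv_iff.mp heq), map_X]
  rw [symbFactor]
  simp only [map_add, map_one, map_mul]
  rw [hθ, hxc, hyc, hxt, hyt]

/-- A scaled twist product with a power weight: the twists outside `P` die, those inside become `1 + T^L · X_{e b}`. -/
theorem prod_twist_pow {A P : Finset (Fin h)} (hP : P ⊆ univ \ A) (L : ℕ) (e : Fin h → Fin (h + h)) :
    (∏ b ∈ univ \ A, (1 + C (if b ∈ P then (Polynomial.X : Polynomial (MvPolynomial (Param h) ℂ)) ^ L else 0) * X (e b)) :
        MvPolynomial (Fin (h + h)) (Polynomial (MvPolynomial (Param h) ℂ))) =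
      ∏ b ∈ P, (1 + C (Polynomial.X ^ L) * X (e b)) := by
  rw [← Finset.prod_subset hP (fun b _ hbP => by rw [if_neg hbP, map_zero, zero_mul, add_zero])]
  exact Finset.prod_congr rfl (fun b hb => by rw [if_pos hb])

/-- The `Q`-polynomial of type `j`: `T^{Lt j} · y_{c_j} · ∏_{b ∈ B_j} (1 + T^L x_b) · ∏_{d ∈ D_j} (1 + T^L y_d)`. -/
def Qpoly (j : Fin J) : MvPolynomial (Fin (h + h)) (Polynomial (MvPolynomial (Param h) ℂ)) :=
  C (Polynomial.X ^ anchW B D j) * X (Fin.natAdd h (c j)) *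
    (∏ b ∈ B j, (1 + C (Polynomial.X ^ tailW J) * X (Fin.castAdd h b))) *
    (∏ d ∈ D j, (1 + C (Polynomial.X ^ tailW J) * X (Fin.natAdd h d)))

variable {a c}

/-- The DESIGNATED anchor `(a | c_j)`: its factor becomes `1 + x_a · Q_j`. -/
theorem map_dtHom_symbFactor_anch (hc : Function.Injective c) (j : Fin J) (haB : a ∉ B j) (hcD : c j ∉ D j) :
    MvPolynomial.map (dtHom a B c D) (symbFactor h (anch a c j)) = 1 + X (xv h a) * Qpoly B c D j := by
  have hmem : a ∈ (anch a c j).1 := by simp [anch]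
  have hP : B j ⊆ univ \ (anch a c j).1 := by
    intro b hb
    simp only [anch, mem_sdiff, mem_univ, mem_singleton, true_and]
    rintro rfl; exact haB hb
  have hQ : D j ⊆ univ \ (anch a c j).2 := by
    intro d hd
    simp only [anch, mem_sdiff, mem_univ, mem_singleton, true_and]
    rintro rfl; exact hcD hd
  rw [symbFactor]
  simp only [map_add, map_one, map_mul, map_prod, map_C, map_X, dtHom_X, dtSpec, if_pos hmem, filter_anch_eq hc j,
    Finset.sum_singleton]
  rw [prod_twist_pow hP, prod_twist_pow hQ]
  simp only [anch, Finset.prod_singleton, Qpoly, xv]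
  ring

/-- A NON-designated anchor containing `a` in its `x`-part: its factor dies (becomes `1`). -/
theorem map_dtHom_symbFactor_of_mem_of_ne {α : Finset (Fin h) × Finset (Fin h)} (hα : a ∈ α.1)
    (hne : ∀ j, anch a c j ≠ α) :
    MvPolynomial.map (dtHom a B c D) (symbFactor h α) = 1 := by
  rw [symbFactor]
  simp only [map_add, map_one, map_mul, map_C, dtHom_X, dtSpec, if_pos hα, filter_anch_empty hne,
    Finset.sum_empty, map_zero, zero_mul, add_zero]

/-- Uniform form on the anchors containing `a`: `1 + x_a · Σ_{j : (a|c_j) = α} Q_j` (the sum has at most one term). -/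
theorem map_dtHom_symbFactor_of_mem (hc : Function.Injective c) (haB : ∀ j, a ∉ B j) (hcD : ∀ j, c j ∉ D j)
    {α : Finset (Fin h) × Finset (Fin h)} (hα : a ∈ α.1) :
    MvPolynomial.map (dtHom a B c D) (symbFactor h α) =
      1 + X (xv h a) * ∑ j ∈ univ.filter (fun j => anch a c j = α), Qpoly B c D j := by
  by_cases hex : ∃ j, anch a c j = α
  · obtain ⟨j, rfl⟩ := hex
    rw [map_dtHom_symbFactor_anch B D hc j (haB j) (hcD j), filter_anch_eq hc j, Finset.sum_singleton]
  · push Not at hex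
    rw [map_dtHom_symbFactor_of_mem_of_ne B D hα hex, filter_anch_empty hex, Finset.sum_empty, mul_zero, add_zero]

/-! ### The substituted witness -/

/-- The `x_a`-free part: the witness with `x_a := 0`, embedded into `T`-polynomial coefficients. -/
def F0 (s h : ℕ) (a : Fin h) : MvPolynomial (Fin (h + h)) (Polynomial (MvPolynomial (Param h) ℂ)) :=
  MvPolynomial.map Polynomial.C (killX (xv h a) (symbolicWitness s h))

/-- **The substituted witness**: `dtSpec(𝔄_s) = F0 · ∏_{α ∈ anchors, a ∈ α.1} (1 + x_a · Σ_{j : α = (a|c_j)} Q_j)`. -/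
theorem map_dtHom_symbolicWitness (s h : ℕ) (a : Fin h) (B : Fin J → Finset (Fin h)) (c : Fin J → Fin h)
    (D : Fin J → Finset (Fin h)) (hc : Function.Injective c) (haB : ∀ j, a ∉ B j) (hcD : ∀ j, c j ∉ D j) :
    MvPolynomial.map (dtHom a B c D) (symbolicWitness s h) =
      F0 s h a * ∏ α ∈ (anchors s h).filter (fun α => a ∈ α.1),
        (1 + X (xv h a) * ∑ j ∈ univ.filter (fun j => anch a c j = α), Qpoly B c D j) := by
  have split : ∀ (f : Finset (Fin h) × Finset (Fin h) → MvPolynomial (Fin (h + h)) (Polynomial (MvPolynomial (Param h) ℂ))),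
      ∏ α ∈ anchors s h, f α =
        (∏ α ∈ (anchors s h).filter (fun α => a ∉ α.1), f α) * ∏ α ∈ (anchors s h).filter (fun α => a ∈ α.1), f α := by
    intro f
    rw [← Finset.prod_filter_mul_prod_filter_not (anchors s h) (fun α => a ∉ α.1)]
    congr 2
    ext α; simp
  rw [F0, symbolicWitness_eq_prod]
  simp only [map_prod]
  rw [split, split]
  have h1 : ∏ α ∈ (anchors s h).filter (fun α => a ∈ α.1),
      MvPolynomial.map Polynomial.C (killX (xv h a) (symbFactor h α)) = 1 :=
    Finset.prod_eq_one (fun α hα => by rw [killX_symbFactor_of_mem a (Finset.mem_filter.mp hα).2, map_one])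
  rw [h1, mul_one]
  congr 1
  · exact Finset.prod_congr rfl (fun α hα => map_dtHom_symbFactor_of_not_mem a B c D (Finset.mem_filter.mp hα).2)
  · exact Finset.prod_congr rfl (fun α hα => map_dtHom_symbFactor_of_mem B D hc haB hcD (Finset.mem_filter.mp hα).2)

/-- `F0` is `x_a`-free. -/
theorem coeff_F0_eq_zero {s : ℕ} {m : Fin (h + h) →₀ ℕ} (hm : m (xv h a) ≠ 0) : coeff m (F0 s h a) = 0 := by
  rw [F0, coeff_map, coeff_killX, if_neg hm, map_zero]

/-- The `a`-free layout coefficients of `F0` are the (embedded) layout coefficients of the witness. -/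
theorem coeff_F0 (s : ℕ) (U V : Finset (Fin h)) (haU : a ∉ U) :
    coeff (pexpo U V) (F0 s h a) = Polynomial.C (coeff (pexpo U V) (symbolicWitness s h)) := by
  rw [F0, coeff_map, coeff_kill_symbolicWitness s h a U V haU]

end Spec

end DTPeel

end

end Summit.ValiantsHypothesis.ValiantsHypothesis.Theorems.BarrierLever.AnchoredPeeling
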